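import Summits.QuantumFields.YangMills.Theorems.FluctuationComparisonRegPrIntLS2BetaKeyLemmaSkeleton
import HarnessLib

/-!
# S2β · letter (D♮) REL-TEL, the (C)-half — THE RELATIVE KEY LEMMA SKELETON: the INHOMOGENEOUS edition of ✓G11 `…KeyLemmaSkeleton`
# (`hj : √Σj² ≤ ε·√Σf² + η` with an ADDITIVE source `η` = the SIZE × ARC junk of the relative (C)-step), one level and the tower
# `‖f_t‖₂ ≤ (Π_{i<t} a_i)·(‖f_0‖₂ + Σ_{s<t} η_s)`, `a_i = (1+θ_i)√(R_iC_i) + ε_i ≥ 1` — UV3-NODE §75.3's «`‖δ(M^tU, M^tU₀)‖₂ ≤ e(√L)^t·‖δ(U,U₀)‖₂ + Σ_{t′<t} SIZE_{t′} × ARC_{t′}`»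

Cell `ym3-torus` (rung R3 = continuum `SU(2)` Yang–Mills on the three-torus — NOT d = 4, NOT infinite volume, NOT a mass gap, NOT Clay).
Width seat «width 10» `ym3-torus-px10` (gen 23), FREE px helper on crux `stmt-QuantumFields-20520`, count-neutral, DEFINITION-FREE; own-risk brick of the px10 lane
«(C)-half of letter (D♮)» (UV3-NODE §82; px16 g21 «GO» 11:28:01Z ∕ 12:12:40Z).  Pure real-sequence bookkeeping (no gauge fields): the relative (C)-step
✓∕⧗`…RelativeOneLevelStep.relOneLevelStep` has the `hstep` shape of ✓G11 with a junk `j Q = C₂τ·β(Q) + C₃L³θ·γ(Q)` whose `ℓ²` norm is NOT dominated by the relative plaquette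
function `f` alone (it carries the relative bond deviations — the ARC input of the (D♮) recursion), so the tower is inhomogeneous; this file is its skeleton.
* §1 ★★ `relKeyLemma_level` — ✓`keyLemma_level` with `hj : √Σj² ≤ ε·√Σf² + η`, `0 ≤ η`: `√Σf′² ≤ ((1+θ)√(RC) + ε)·√Σf² + η`.
* §2 `le_prod_mul_add_sum` (real sequences: `x_{t+1} ≤ a_t·x_t + η_t`, `1 ≤ a_t`, `0 ≤ η_t`, `0 ≤ x_0` ⟹ `x_t ≤ (Π_{i<t} a_i)·(x_0 + Σ_{s<t} η_s)`), ★★★ `relKeyLemma_tower`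
  (the tower: `√Σ(f_t)² ≤ (Π_{i<t}((1+θ_i)√(R_iC_i) + ε_i))·(√Σ(f_0)² + Σ_{s<t} η_s)` when every factor is `≥ 1`), ★★ `relKeyLemma_tower_sqrtL` (`R_iC_i = L ≥ 1`:
  `≤ (√L)^t·exp(Σ_{i<t}(θ_i + ε_i∕√L))·(‖f_0‖₂ + Σ_{s<t} η_s)` — depth-free as soon as `Σθ`, `Σε` are bounded; the `η_s` are summed UNWEIGHTED, the consumer discounts them
  level by level if it wishes via §2 with the sharper weights).

HONEST SCOPE.  Elementary real analysis over ✓G11; nothing of Bałaban's asserted; the instantiation on the T³ record (thresholds `θ_t`, the `ℓ²` suppliers of `β`, `γ` — px21 g23's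
F4-rel ∕ relative word Stokes), (D♮), (F-ax), GAP♯∘ (`stub_uniformFibreGapOrbit`), S2β, crux 20520 and `YM3TorusSU2` are NOT proved; no registered stub is closed; the Yang–Mills
mass gap is NOT proved.  Sorry-free, axioms standard.
References: T. Bałaban, CMP **99** (1985) 75–102 [Balaban1985RegularSpaces] (Lemma 1 p.79, Thm 2 (1.36)–(1.39) p.83 — the printed one-step loci); CMP **98** (1985) 17–51
[Balaban1985Averaging] ((19) p.21).
-/

set_option autoImplicit false

noncomputable section

namespace Summit.QuantumFields.YangMills.Theorems.FluctuationComparisonRegPrIntLS2BetaRelativeKeyLemmaSkeleton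

open Finset
open scoped BigOperators
open Summit.QuantumFields.YangMills.Theorems.FluctuationComparisonRegPrIntLS2BetaKeyLemmaSkeleton (keyLemma_level)

/-! ## §1 One level, inhomogeneous -/

/-- ★★ **THE RELATIVE KEY LEMMA, ONE LEVEL**: ✓`keyLemma_level` with an ADDITIVE source in the junk bound — if `f′ a ≤ (1+θ)·Σ_b K a b·f b + j a` for a kernel with row sums
`≤ R`, column sums `≤ C`, and `√Σ j² ≤ ε·√Σ f² + η` (`0 ≤ η`), then `√Σ f′² ≤ ((1+θ)·√(RC) + ε)·√Σ f² + η`. [folklore] -/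
theorem relKeyLemma_level {α β : Type*} [Fintype α] [Fintype β] (K : α → β → ℝ) (hK : ∀ a b, 0 ≤ K a b) {R C : ℝ} (hR : 0 ≤ R)
    (hrow : ∀ a, ∑ b, K a b ≤ R) (hcol : ∀ b, ∑ a, K a b ≤ C) (f : β → ℝ) (f' j : α → ℝ) (hf' : ∀ a, 0 ≤ f' a)
    {θ ε η : ℝ} (hθ : 0 ≤ θ) (hstep : ∀ a, f' a ≤ (1 + θ) * ∑ b, K a b * f b + j a)
    (hj : √(∑ a, j a ^ 2) ≤ ε * √(∑ b, f b ^ 2) + η) :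
    √(∑ a, f' a ^ 2) ≤ ((1 + θ) * √(R * C) + ε) * √(∑ b, f b ^ 2) + η := by
  -- ✓`keyLemma_level`'s two-line Minkowski + Schur argument, with the extra source `η` carried along
  have hM := FluctuationComparisonRegPrIntLS2BetaKeyLemmaSkeleton.sqrt_sum_sq_le_of_le_add Finset.univ f' (fun a => (1 + θ) * ∑ b, K a b * f b) j
    (fun a _ => hf' a) (fun a _ => hstep a)
  have hS := FluctuationComparisonRegPrIntLS2BetaSchurTest.schur_test_sq Finset.univ Finset.univ K (fun a _ b _ => hK a b) hR (fun a _ => hrow a) (fun b _ => hcol b) f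
  have hT : √(∑ a, ((1 + θ) * ∑ b, K a b * f b) ^ 2) ≤ (1 + θ) * √(R * C) * √(∑ b, f b ^ 2) := by
    have e : ∑ a, ((1 + θ) * ∑ b, K a b * f b) ^ 2 = (1 + θ) ^ 2 * ∑ a, (∑ b, K a b * f b) ^ 2 := by
      rw [Finset.mul_sum]; exact Finset.sum_congr rfl fun a _ => by ring
    rw [e, Real.sqrt_mul (sq_nonneg _), Real.sqrt_sq (by linarith), mul_assoc, ← Real.sqrt_mul' _ (Finset.sum_nonneg fun _ _ => sq_nonneg _)]
    gcongr
  calc √(∑ a, f' a ^ 2) ≤ √(∑ a, ((1 + θ) * ∑ b, K a b * f b) ^ 2) + √(∑ a, j a ^ 2) := hM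
    _ ≤ (1 + θ) * √(R * C) * √(∑ b, f b ^ 2) + (ε * √(∑ b, f b ^ 2) + η) := add_le_add hT hj
    _ = ((1 + θ) * √(R * C) + ε) * √(∑ b, f b ^ 2) + η := by ring

/-! ## §2 The inhomogeneous tower -/

/-- **INHOMOGENEOUS LINEAR RECURSION**: `x (t+1) ≤ a t·x t + η t` with `1 ≤ a t`, `0 ≤ η t`, `0 ≤ x 0` gives `x t ≤ (Π_{i<t} a i)·(x 0 + Σ_{s<t} η s)`. [folklore] -/
theorem le_prod_mul_add_sum (x a η : ℕ → ℝ) (hx0 : 0 ≤ x 0) (ha : ∀ t, 1 ≤ a t) (hη : ∀ t, 0 ≤ η t)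
    (hrec : ∀ t, x (t + 1) ≤ a t * x t + η t) :
    ∀ t : ℕ, x t ≤ (∏ i ∈ range t, a i) * (x 0 + ∑ s ∈ range t, η s)
  | 0 => by simp
  | t + 1 => by
    have ih := le_prod_mul_add_sum x a η hx0 ha hη hrec t
    have hP1 : 1 ≤ ∏ i ∈ range t, a i := by
      have h := Finset.prod_le_prod (s := range t) (fun i _ => (zero_le_one : (0 : ℝ) ≤ 1)) (fun i _ => ha i)
      simpa using h
    have hP0 : 0 ≤ ∏ i ∈ range t, a i := le_trans zero_le_one hP1
    have hS0 : 0 ≤ x 0 + ∑ s ∈ range t, η s := add_nonneg hx0 (Finset.sum_nonneg fun s _ => hη s)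
    have hat : 0 ≤ a t := le_trans zero_le_one (ha t)
    rw [Finset.prod_range_succ, Finset.sum_range_succ]
    calc x (t + 1) ≤ a t * x t + η t := hrec t
      _ ≤ a t * ((∏ i ∈ range t, a i) * (x 0 + ∑ s ∈ range t, η s)) + η t := add_le_add (mul_le_mul_of_nonneg_left ih hat) le_rfl
      _ ≤ a t * ((∏ i ∈ range t, a i) * (x 0 + ∑ s ∈ range t, η s)) + (∏ i ∈ range t, a i) * a t * η t := by
          have h1 : η t ≤ (∏ i ∈ range t, a i) * a t * η t := by
            have := mul_le_mul_of_nonneg_right (one_le_mul_of_one_le_of_one_le hP1 (ha t)) (hη t)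
            linarith
          linarith
      _ = (∏ i ∈ range t, a i) * a t * (x 0 + (∑ s ∈ range t, η s + η t)) := by ring

/-- ★★★ **THE RELATIVE KEY LEMMA, TOWER**: levels `α t`, functions `f t : α t → ℝ≥0`, kernels `K t` (rows `≤ R t`, columns `≤ C t`), thresholds `θ t ≥ 0`, `ε t`, sources `η t ≥ 0`;
if at every level `f (t+1) a ≤ (1 + θ t)·Σ_b K t a b·f t b + j t a` and `√Σ(j t)² ≤ ε t·√Σ(f t)² + η t`, and every factor `(1+θ t)√(R t·C t) + ε t ≥ 1`, then
`√Σ(f t)² ≤ (Π_{i<t}((1+θ i)√(R iC i) + ε i))·(√Σ(f 0)² + Σ_{s<t} η s)`. [folklore] -/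
theorem relKeyLemma_tower (α : ℕ → Type*) [∀ t, Fintype (α t)] (f : (t : ℕ) → α t → ℝ) (hf : ∀ t a, 0 ≤ f t a)
    (K : (t : ℕ) → α (t + 1) → α t → ℝ) (hK : ∀ t a b, 0 ≤ K t a b) (R C θ ε η : ℕ → ℝ) (hR : ∀ t, 0 ≤ R t)
    (hrow : ∀ t a, ∑ b, K t a b ≤ R t) (hcol : ∀ t b, ∑ a, K t a b ≤ C t) (hθ : ∀ t, 0 ≤ θ t) (hη : ∀ t, 0 ≤ η t)
    (hone : ∀ t, 1 ≤ (1 + θ t) * √(R t * C t) + ε t)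
    (j : (t : ℕ) → α (t + 1) → ℝ)
    (hstep : ∀ t a, f (t + 1) a ≤ (1 + θ t) * ∑ b, K t a b * f t b + j t a)
    (hj : ∀ t, √(∑ a, j t a ^ 2) ≤ ε t * √(∑ b, f t b ^ 2) + η t) (t : ℕ) :
    √(∑ a, f t a ^ 2) ≤ (∏ i ∈ range t, ((1 + θ i) * √(R i * C i) + ε i)) * (√(∑ b, f 0 b ^ 2) + ∑ s ∈ range t, η s) :=
  le_prod_mul_add_sum (fun t => √(∑ a, f t a ^ 2)) (fun i => (1 + θ i) * √(R i * C i) + ε i) η (Real.sqrt_nonneg _) hone hη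
    (fun i => relKeyLemma_level (K i) (hK i) (hR i) (hrow i) (hcol i) (f i) (f (i + 1)) (j i) (hf (i + 1)) (hθ i) (hstep i) (hj i)) t

/-- ★★ **THE `√L` READING**: if `R i·C i = L` (`1 ≤ L`) at every level then
`√Σ(f t)² ≤ (√L)^t·exp(Σ_{i<t}(θ i + ε i∕√L))·(√Σ(f 0)² + Σ_{s<t} η s)` — a DEPTH-FREE constant in front of `(√L)^t` as soon as `Σθ`, `Σε` are bounded; the sources `η s`
enter additively (UV3-NODE §75.3's «`+ Σ_{t′<t} SIZE_{t′} × ARC_{t′}`»). [folklore] -/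
theorem relKeyLemma_tower_sqrtL (α : ℕ → Type*) [∀ t, Fintype (α t)] (f : (t : ℕ) → α t → ℝ) (hf : ∀ t a, 0 ≤ f t a)
    (K : (t : ℕ) → α (t + 1) → α t → ℝ) (hK : ∀ t a b, 0 ≤ K t a b) {L : ℝ} (hL : 1 ≤ L) (R C θ ε η : ℕ → ℝ) (hR : ∀ t, 0 ≤ R t)
    (hRC : ∀ t, R t * C t = L)
    (hrow : ∀ t a, ∑ b, K t a b ≤ R t) (hcol : ∀ t b, ∑ a, K t a b ≤ C t) (hθ : ∀ t, 0 ≤ θ t) (hε : ∀ t, 0 ≤ ε t) (hη : ∀ t, 0 ≤ η t)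
    (j : (t : ℕ) → α (t + 1) → ℝ)
    (hstep : ∀ t a, f (t + 1) a ≤ (1 + θ t) * ∑ b, K t a b * f t b + j t a)
    (hj : ∀ t, √(∑ a, j t a ^ 2) ≤ ε t * √(∑ b, f t b ^ 2) + η t) (t : ℕ) :
    √(∑ a, f t a ^ 2) ≤ Real.sqrt L ^ t * Real.exp (∑ i ∈ range t, (θ i + ε i / Real.sqrt L)) * (√(∑ b, f 0 b ^ 2) + ∑ s ∈ range t, η s) := by
  have hsL : 1 ≤ Real.sqrt L := by rw [← Real.sqrt_one]; exact Real.sqrt_le_sqrt hL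
  have hsL0 : 0 < Real.sqrt L := by linarith
  have hone : ∀ i, 1 ≤ (1 + θ i) * √(R i * C i) + ε i := fun i => by
    rw [hRC i]
    have h1 : 1 ≤ (1 + θ i) * Real.sqrt L := one_le_mul_of_one_le_of_one_le (by linarith [hθ i]) hsL
    linarith [hε i]
  have h := relKeyLemma_tower α f hf K hK R C θ ε η hR hrow hcol hθ hη hone j hstep hj t
  refine h.trans (mul_le_mul_of_nonneg_right ?_ (add_nonneg (Real.sqrt_nonneg _) (Finset.sum_nonneg fun s _ => hη s)))
  -- each factor: `(1+θ)√L + ε = √L·(1 + (θ + ε/√L)) ≤ √L·exp(θ + ε/√L)`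
  have hfac : ∀ i, (1 + θ i) * √(R i * C i) + ε i ≤ Real.sqrt L * Real.exp (θ i + ε i / Real.sqrt L) := fun i => by
    rw [hRC i]
    have e : (1 + θ i) * Real.sqrt L + ε i = Real.sqrt L * (1 + (θ i + ε i / Real.sqrt L)) := by field_simp; ring
    rw [e]
    exact mul_le_mul_of_nonneg_left (by linarith [Real.add_one_le_exp (θ i + ε i / Real.sqrt L)]) hsL0.le
  calc ∏ i ∈ range t, ((1 + θ i) * √(R i * C i) + ε i) ≤ ∏ i ∈ range t, (Real.sqrt L * Real.exp (θ i + ε i / Real.sqrt L)) :=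
        Finset.prod_le_prod (fun i _ => le_trans zero_le_one (hone i)) (fun i _ => hfac i)
    _ = Real.sqrt L ^ t * Real.exp (∑ i ∈ range t, (θ i + ε i / Real.sqrt L)) := by
        rw [Finset.prod_mul_distrib, Finset.prod_const, Finset.card_range, Real.exp_sum]

end Summit.QuantumFields.YangMills.Theorems.FluctuationComparisonRegPrIntLS2BetaRelativeKeyLemmaSkeleton

end
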